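import Summits.QuantumFields.BalabanUV.Beta.GAN24.HkGradientKingRate
import Literature.MathematicalPhysics.QuantumFieldTheory.Balaban1983to89.T4EtaRateOperatorTorus
import Summits.QuantumFields.BalabanUV.T4Continuum.Support.CellTaylorPlanting

/-!
# `BalabanUV.Beta.GAN24.GradientVertexChainKing` — binder row G-an2-4 ∕ (CONV-C), route R7, road P2: THE FIRST CHAIN WITH A DIFFERENCE VERTEX —
# the unit-lattice kernel `K^{(n)}(y,λ; y′,λ′) = Σ_x η^{d+1} Σ_{ij} m(x,i,j)·∂H_n[i](x; y,λ)·∂H_n[j](x; y′,λ′)` of TWO GRADIENT LEGS of Bałaban's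
# minimiser joined by a LOCAL VERTEX `m` obeys BOTH (CONV-C) CLAUSES (uniform decay `e^{−(dec∕2)|y−y′|_T}` and the one-step rate
# `max(θG, θ_m)^k`) — by LEIBNIZ over the children of King's parent map, from this lineage's gradient-leg law (`HkGradientKingRate`), b05's
# decaying sup bound of the gradient kernel, and the vertex's own displayed transport letter

NOT IN PRINT; OUR PROOF ATTEMPT (unit `b2b-balaban-gan24-p2`, gen 31 = prover-b2b-balaban-gan24-p2-g31-0, road-P2 chair of row G-an2-4;
CRUX TEAM (2) under the ruling «YM REDIRECT TOWARDS THE SUMMIT», 2026-08-21).  HONEST FRAMING (cell contract, verbatim): «discharging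
`BetaPertH` makes Bałaban's UV stability UNCONDITIONAL — a real constructive-QFT result; it is NOT the continuum limit and NOT the Clay
problem.»  HONEST DEPENDENCY (verbatim): «continuum YM on T⁴ ⇐ BetaPertH ∧ nine spine estimates (0/9 proved); BetaPertH ⇐ (D1) ∧ (D4) ∧
CAP+tail; G-an2-4 gates asym, D1 and NE2/3/4.»  ABSOLUTE RULE: nothing printed is a hypothesis; no `def … : Prop`, no `sorry`; [folklore]
bookkeeping BY NAME.  The VERTEX `m` is a PARAMETER with DISPLAYED letters (sup bound `B`, two-level transport `εm`): this file does NOT say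
which of an1's rows T1–T3 is an instance (S1 is an2∕p1's), it proves the Leibniz shape for the whole class.

## Content (0 sorry; `U = 1`, torus model, dimension `d+1 ≥ 1`, every period vector `M`)
 * §1 `vtxChain n M m s s′ := Σ_x (n^{d+1})⁻¹ Σ_{i j : Fin(d+1)²} m x i j · dker_i(x; s) · dker_j(x; s′)` (two gradient legs at one fine point, a vertex weight).
 * §2 child sum `Σ_{x′}(RN)^{−(d+1)}G(par x′) = Σ_x N^{−(d+1)}G(x)` (NE2 leaf-05's tiling BY NAME), `sum_blockConst`, and the two-centre decay sum
   `Σ_t e^{−δ|t−y|}e^{−δ|t−y′|} ≤ latticeConst(d+1,δ∕2)·e^{−(δ∕2)|y−y′|_T}` (`sum_exp_two_centre_le`, via `T4EtaRateOperatorTorus.torusSupNorm_add_le`).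
 * §3 **`norm_vtxChain_le`** (DECAY): `|m| ≤ B ⇒ ‖K^{(n)}‖ ≤ (d+1)⁴·B·CdecD²·latticeConst·e^{−(dec∕2)|y−y′|_T}`, every level.
 * §4 **`norm_vtxChain_succ_sub_le_lev`** (ONE STEP along `n_k = L^k`, `L ≥ 2`, `0 ≤ α < 1`): vertex letters `|m′|,|m| ≤ B`, `‖m′(x′) − m(par x′)‖ ≤ εm` ⇒
   `‖K^{(n_{k+1})}[m′] − K^{(n_k)}[m]‖ ≤ (d+1)⁴·(2·B·CdecD·CG(d,α,L)·θG(L,α)^k + CdecD²·εm)·latticeConst·e^{−(dec∕2)|y−y′|_T}` (Leibniz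
   `d′m′d′ − (d∘par)m(d∘par) = (d′−d∘par)m′d′ + (d∘par)(m′−m∘par)d′ + (d∘par)m(d′−d∘par)` under the child sum).  Instances: `TwoLegChainInstances`.
HONEST.  [folklore] finite sums; the legs' inputs are b05's `norm_dker_bpt_le` (decay) and this lineage's `norm_dker_par_sub_le_lev` (rate); exponent
`α∕2` per level inherited (interpolation artefact; idea-1 toy: true sup order `η log(1∕η)`); which T-row (if any) a given `m` realises is NOT claimed;
NOT (CONV-C) as a whole, NEVER «G-an2-4 closed», NOT NE2, NOT D1, NOT BetaPertH, NOT continuum, NOT Clay.  Text locations only: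
[Balaban1984PropagatorsI] (1.31) p. 23, (1.63) p. 28; [King1986] p. 664, §4 p. 672 (the Leibniz «successively replace each factor» mechanism).
-/

noncomputable section

open scoped BigOperators
open Finset

namespace Summit.QuantumFields.BalabanUV.Beta.GAN24.GradientVertexChainKing

open Literature.MathematicalPhysics.QuantumFieldTheory.Balaban1983to89
open Literature.MathematicalPhysics.QuantumFieldTheory.Balaban1983to89.B5Prop11Plancherel (Tor fine)
open Literature.MathematicalPhysics.QuantumFieldTheory.Balaban1983to89.B4TorusKernel.MultiPeriod (torusSupNorm)
open Literature.MathematicalPhysics.QuantumFieldTheory.Balaban1983to89.B4Sect5Proof (latticeConst latticeConst_nonneg)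
open Literature.MathematicalPhysics.QuantumFieldTheory.Balaban1983to89.B5Block118 (bpt)
open Literature.MathematicalPhysics.QuantumFieldTheory.Balaban1983to89.B5Blocks16 (blockOf)
open Literature.MathematicalPhysics.QuantumFieldTheory.Balaban1983to89.B6LowerBound2153Torus (toT rep toT_rep)
open Literature.MathematicalPhysics.QuantumFieldTheory.Balaban1983to89.B5G183RateUnitTower (lev lev_neZero)
open Literature.MathematicalPhysics.QuantumFieldTheory.Balaban1983to89.B5Hk163TorusHolder (dker)
open Literature.MathematicalPhysics.QuantumFieldTheory.Balaban1983to89.B5Hk163TorusHolderDecay (CdecD CdecD_nonneg norm_dker_bpt_le)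
open Literature.MathematicalPhysics.QuantumFieldTheory.Balaban1983to89.B5Hk163TorusHolderRate (sum_exp_torusSupNorm_sub_rep_le)
open Literature.MathematicalPhysics.QuantumFieldTheory.Balaban1983to89.Beta.FluctuationProjection (digitOf bpt_blockOf_digitOf)
open Literature.MathematicalPhysics.QuantumFieldTheory.Balaban1983to89.T4EtaRateOperatorTorus (torusSupNorm_add_le torusSupNorm_neg)
open Summit.QuantumFields.BalabanUV.T4Continuum.BalabanAveragedTowerModes (par par_cpt_add_off)
open Summit.QuantumFields.BalabanUV.T4Continuum.CellTaylorPlanting (sum_fine_eq_sum_tile_real)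
open Summit.QuantumFields.BalabanUV.T4Continuum.BalabanBlockPoincare (tileEquiv)
open Summit.QuantumFields.BalabanUV.Beta.GAN24.HkKingOneStep (dec dec_pos)
open Summit.QuantumFields.BalabanUV.Beta.GAN24.HkKingOneStepSup (parDigit eq_bpt_and_par_eq)
open Summit.QuantumFields.BalabanUV.Beta.GAN24.HkGradientKingRate (thetaG thetaG_pos thetaG_lt_one CG CG_nonneg dec_eq norm_dker_par_sub_le_lev)

variable {d : ℕ}

/-! ## §1 The vertex chain -/

section Defs

variable (n : ℕ) [NeZero n] (M : Fin (d + 1) → ℕ) [hM : ∀ μ, NeZero (M μ)]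

/-- the vertex index: (leg component, difference direction). [folklore] -/
abbrev VIdx (d : ℕ) : Type := Fin (d + 1) × Fin (d + 1)

/-- **THE VERTEX CHAIN** `K^{(n)}(y,λ;y′,λ′) = Σ_x (n^{d+1})⁻¹ Σ_{i j} m x i j · ∂_{i.2}H_n[i.1,λ](x;y) · ∂_{j.2}H_n[j.1,λ′](x;y′)` — two gradient legs at the same
fine point joined by a local vertex weight, Riemann-summed over the fine torus. [folklore] -/
def vtxChain (m : Tor (fine n M) → VIdx d → VIdx d → ℂ) (s s' : Tor M × Fin (d + 1)) : ℂ :=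
  ∑ x : Tor (fine n M), ((((n : ℝ) ^ (d + 1))⁻¹ : ℝ) : ℂ) *
    ∑ i : VIdx d, ∑ j : VIdx d, m x i j * dker n M i.1 s.2 i.2 x s.1 * dker n M j.1 s'.2 j.2 x s'.1

end Defs

/-! ## §2 Child sums and the two-centre block decay sum -/

section Sums

variable {N R : ℕ} [NeZero N] [NeZero R] (M : Fin (d + 1) → ℕ) [hM : ∀ μ, NeZero (M μ)]

/-- **THE CHILD SUM**: `Σ_{x′ : fine(RN)} G(par x′) = R^{d+1} · Σ_{x : fine N} G(x)` (each coarse point has `R^{d+1}` children; NE2 leaf-05's tiling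
`sum_fine_eq_sum_tile_real` + `par_cpt_add_off`). [folklore] -/
theorem sum_comp_par (G : Tor (fine N M) → ℝ) :
    ∑ x' : Tor (fine (R * N) M), G (par N R M x') = (R : ℝ) ^ (d + 1) * ∑ x : Tor (fine N M), G x := by
  rw [sum_fine_eq_sum_tile_real N R M (fun x' => G (par N R M x'))]
  simp only [par_cpt_add_off, Finset.sum_const, Finset.card_univ, nsmul_eq_mul]
  rw [Finset.mul_sum]
  refine Finset.sum_congr rfl fun x _ => ?_
  rw [Fintype.card_pi]
  simp only [Fintype.card_fin, Finset.prod_const, Finset.card_univ]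
  push_cast; ring

omit [NeZero R] in
/-- the points of the level-`N` fine torus, block by block: `Σ_x F(ȳ(x)) = N^{d+1}·Σ_{blocks t} F(rep t)` for block-constant summands. [folklore] -/
theorem sum_blockConst (F : (Fin (d + 1) → ℤ) → ℝ) :
    ∑ x : Tor (fine N M), (((N : ℝ)) ^ (d + 1))⁻¹ * F (rep M (blockOf N M x)) = ∑ t : Tor M, F (rep M t) := by
  have hN : (N : ℝ) ≠ 0 := by exact_mod_cast NeZero.ne N
  -- tile the level-`N` torus over the unit torus: `fine N M = N * (fine 1 M)`-free route — use the block/digit bijection `x ↦ (blockOf x, digitOf x)`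
  have hbij : ∑ x : Tor (fine N M), F (rep M (blockOf N M x)) = ∑ p : Tor M × (Fin (d + 1) → Fin N), F (rep M p.1) := by
    refine Fintype.sum_equiv ⟨fun x => (blockOf N M x, digitOf N M x), fun p => bpt N M p.1 p.2, fun x => ?_, fun p => ?_⟩ _ _ (fun x => rfl)
    · exact bpt_blockOf_digitOf N M x
    · obtain ⟨t, j⟩ := p
      simp only [Prod.mk.injEq]
      exact ⟨B5Blocks16.blockOf_bpt N M t j, Beta.FluctuationProjection.digitOf_bpt N M t j⟩
  rw [← Finset.mul_sum, hbij, Fintype.sum_prod_type]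
  simp only [Finset.sum_const, Finset.card_univ, Fintype.card_pi, Fintype.card_fin, Finset.prod_const, nsmul_eq_mul]
  rw [Finset.mul_sum]
  refine Finset.sum_congr rfl fun t _ => ?_
  push_cast
  rw [← mul_assoc, inv_mul_cancel₀ (pow_ne_zero _ hN), one_mul]

omit [NeZero N] [NeZero R] in
/-- **THE TWO-CENTRE DECAY SUM over the unit torus**: `Σ_t e^{−δ|rep t − y|}·e^{−δ|rep t − y′|} ≤ latticeConst(d+1, δ∕2)·e^{−(δ∕2)|y − y′|_T}` (`δ > 0`):
half of each exponent pays the distance between the two sources (triangle inequality `torusSupNorm_add_le`), the other half is summed by King's lattice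
constant. [folklore] -/
theorem sum_exp_two_centre_le {δ : ℝ} (hδ : 0 < δ) (y y' : Fin (d + 1) → ℤ) :
    ∑ t : Tor M, Real.exp (-(δ * torusSupNorm M (rep M t - y))) * Real.exp (-(δ * torusSupNorm M (rep M t - y')))
      ≤ latticeConst (d + 1) (δ / 2) * Real.exp (-(δ / 2 * torusSupNorm M (y - y'))) := by
  have htri : ∀ t : Tor M, torusSupNorm M (y - y') ≤ torusSupNorm M (rep M t - y) + torusSupNorm M (rep M t - y') := fun t => by
    have h := torusSupNorm_add_le M (-(rep M t - y)) (rep M t - y')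
    rw [torusSupNorm_neg] at h
    have e : -(rep M t - y) + (rep M t - y') = y - y' := by ring
    rwa [e] at h
  have hpt : ∀ t : Tor M,
      Real.exp (-(δ * torusSupNorm M (rep M t - y))) * Real.exp (-(δ * torusSupNorm M (rep M t - y')))
        ≤ Real.exp (-(δ / 2 * torusSupNorm M (y - y'))) * Real.exp (-(δ / 2 * torusSupNorm M (y - rep M t))) := fun t => by
    rw [← Real.exp_add, ← Real.exp_add]
    apply Real.exp_le_exp.mpr
    have h1 := htri t
    have h2 : torusSupNorm M (y - rep M t) = torusSupNorm M (rep M t - y) := by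
      rw [← torusSupNorm_neg M (y - rep M t), neg_sub]
    rw [h2]
    have h3 : 0 ≤ torusSupNorm M (rep M t - y') :=
      B4TorusKernel.MultiPeriod.torusSupNorm_nonneg (B6Cov2156Torus.one_le_M M) _
    nlinarith
  calc _ ≤ ∑ t : Tor M, Real.exp (-(δ / 2 * torusSupNorm M (y - y'))) * Real.exp (-(δ / 2 * torusSupNorm M (y - rep M t))) :=
        Finset.sum_le_sum fun t _ => hpt t
    _ = Real.exp (-(δ / 2 * torusSupNorm M (y - y'))) * ∑ t : Tor M, Real.exp (-(δ / 2 * torusSupNorm M (y - rep M t))) := by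
        rw [Finset.mul_sum]
    _ ≤ Real.exp (-(δ / 2 * torusSupNorm M (y - y'))) * latticeConst (d + 1) (δ / 2) :=
        mul_le_mul_of_nonneg_left (sum_exp_torusSupNorm_sub_rep_le M (half_pos hδ) y) (Real.exp_pos _).le
    _ = _ := mul_comm _ _

end Sums

/-! ## §3 The decay clause -/

section Decay

variable (n : ℕ) [NeZero n] (M : Fin (d + 1) → ℕ) [hM : ∀ μ, NeZero (M μ)]

/-- the gradient kernel at an arbitrary fine point, with decay from its block: `‖dker n M μ λ ν x y‖ ≤ CdecD(d)·e^{−dec(d)·|ȳ(x) − y|_T}`. [folklore] -/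
theorem norm_dker_le_block (μ lam ν : Fin (d + 1)) (x : Tor (fine n M)) (y : Fin (d + 1) → ℤ) :
    ‖dker n M μ lam ν x (toT M y)‖ ≤ CdecD d * Real.exp (-(dec d * torusSupNorm M (rep M (blockOf n M x) - y))) := by
  have hx : x = bpt n M (toT M (rep M (blockOf n M x))) (digitOf n M x) := by rw [toT_rep, bpt_blockOf_digitOf]
  have h := norm_dker_bpt_le n M μ lam ν (digitOf n M x) (rep M (blockOf n M x)) y
  rw [← hx, ← dec_eq] at h
  exact h

/-- the inner vertex sum at one fine point: `‖Σ_{ij} m x i j·d_i(x;y)·d_j(x;y′)‖ ≤ (d+1)⁴·B·CdecD²·e^{−dec|ȳ(x)−y|}e^{−dec|ȳ(x)−y′|}`. [folklore] -/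
theorem norm_vertex_sum_le (m : Tor (fine n M) → VIdx d → VIdx d → ℂ) {B : ℝ} (hm : ∀ x i j, ‖m x i j‖ ≤ B) (x : Tor (fine n M))
    (y y' : Fin (d + 1) → ℤ) (lam lam' : Fin (d + 1)) :
    ‖∑ i : VIdx d, ∑ j : VIdx d, m x i j * dker n M i.1 lam i.2 x (toT M y) * dker n M j.1 lam' j.2 x (toT M y')‖
      ≤ ((d : ℝ) + 1) ^ 4 * B * CdecD d ^ 2 * (Real.exp (-(dec d * torusSupNorm M (rep M (blockOf n M x) - y)))
          * Real.exp (-(dec d * torusSupNorm M (rep M (blockOf n M x) - y')))) := by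
  set E := Real.exp (-(dec d * torusSupNorm M (rep M (blockOf n M x) - y)))
  set E' := Real.exp (-(dec d * torusSupNorm M (rep M (blockOf n M x) - y')))
  have hB : 0 ≤ B := (norm_nonneg _).trans (hm x (0, 0) (0, 0))
  have hC : 0 ≤ CdecD d := CdecD_nonneg
  have hterm : ∀ i j : VIdx d, ‖m x i j * dker n M i.1 lam i.2 x (toT M y) * dker n M j.1 lam' j.2 x (toT M y')‖ ≤ B * (CdecD d * E) * (CdecD d * E') :=
    fun i j => by
      rw [norm_mul, norm_mul]
      exact mul_le_mul (mul_le_mul (hm x i j) (norm_dker_le_block n M i.1 lam i.2 x y) (norm_nonneg _) hB)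
        (norm_dker_le_block n M j.1 lam' j.2 x y') (norm_nonneg _) (mul_nonneg hB (mul_nonneg hC (Real.exp_pos _).le))
  calc _ ≤ ∑ i : VIdx d, ‖∑ j : VIdx d, m x i j * dker n M i.1 lam i.2 x (toT M y) * dker n M j.1 lam' j.2 x (toT M y')‖ := norm_sum_le _ _
    _ ≤ ∑ i : VIdx d, ∑ j : VIdx d, ‖m x i j * dker n M i.1 lam i.2 x (toT M y) * dker n M j.1 lam' j.2 x (toT M y')‖ :=
        Finset.sum_le_sum fun i _ => norm_sum_le _ _
    _ ≤ ∑ _i : VIdx d, ∑ _j : VIdx d, B * (CdecD d * E) * (CdecD d * E') :=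
        Finset.sum_le_sum fun i _ => Finset.sum_le_sum fun j _ => hterm i j
    _ = ((d : ℝ) + 1) ^ 4 * B * CdecD d ^ 2 * (E * E') := by
        simp only [Finset.sum_const, Finset.card_univ, Fintype.card_prod, Fintype.card_fin, nsmul_eq_mul]
        push_cast; ring

/-- **THE DECAY CLAUSE OF THE VERTEX CHAIN** (every level `n`, every torus): `|m| ≤ B` ⇒
`‖K^{(n)}(y,λ;y′,λ′)‖ ≤ (d+1)⁴·B·CdecD(d)²·latticeConst(d+1, dec∕2)·e^{−(dec(d)∕2)·|y−y′|_T}`. [folklore] -/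
theorem norm_vtxChain_le (m : Tor (fine n M) → VIdx d → VIdx d → ℂ) {B : ℝ} (hm : ∀ x i j, ‖m x i j‖ ≤ B) (y y' : Fin (d + 1) → ℤ)
    (lam lam' : Fin (d + 1)) :
    ‖vtxChain n M m (toT M y, lam) (toT M y', lam')‖
      ≤ ((d : ℝ) + 1) ^ 4 * B * CdecD d ^ 2 * latticeConst (d + 1) (dec d / 2) * Real.exp (-(dec d / 2 * torusSupNorm M (y - y'))) := by
  have hB : 0 ≤ B := (norm_nonneg _).trans (hm 0 (0, 0) (0, 0))
  have hC : 0 ≤ CdecD d := CdecD_nonneg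
  have hn : (0 : ℝ) < (n : ℝ) ^ (d + 1) := by have := Nat.pos_of_ne_zero (NeZero.ne n); positivity
  have hK : 0 ≤ ((d : ℝ) + 1) ^ 4 * B * CdecD d ^ 2 := by positivity
  unfold vtxChain
  calc _ ≤ ∑ x : Tor (fine n M), ‖((((n : ℝ) ^ (d + 1))⁻¹ : ℝ) : ℂ) *
          ∑ i : VIdx d, ∑ j : VIdx d, m x i j * dker n M i.1 lam i.2 x (toT M y) * dker n M j.1 lam' j.2 x (toT M y')‖ := norm_sum_le _ _
    _ ≤ ∑ x : Tor (fine n M), (((n : ℝ) ^ (d + 1))⁻¹) * (((d : ℝ) + 1) ^ 4 * B * CdecD d ^ 2 *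
          (Real.exp (-(dec d * torusSupNorm M (rep M (blockOf n M x) - y))) * Real.exp (-(dec d * torusSupNorm M (rep M (blockOf n M x) - y'))))) := by
        refine Finset.sum_le_sum fun x _ => ?_
        rw [norm_mul, Complex.norm_real, Real.norm_of_nonneg (inv_nonneg.mpr hn.le)]
        exact mul_le_mul_of_nonneg_left (norm_vertex_sum_le n M m hm x y y' lam lam') (inv_nonneg.mpr hn.le)
    _ = ((d : ℝ) + 1) ^ 4 * B * CdecD d ^ 2 * ∑ x : Tor (fine n M), (((n : ℝ) ^ (d + 1))⁻¹) *
          (Real.exp (-(dec d * torusSupNorm M (rep M (blockOf n M x) - y))) * Real.exp (-(dec d * torusSupNorm M (rep M (blockOf n M x) - y')))) := by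
        rw [Finset.mul_sum]; refine Finset.sum_congr rfl fun x _ => ?_; ring
    _ = ((d : ℝ) + 1) ^ 4 * B * CdecD d ^ 2 *
          ∑ t : Tor M, Real.exp (-(dec d * torusSupNorm M (rep M t - y))) * Real.exp (-(dec d * torusSupNorm M (rep M t - y'))) := by
        rw [sum_blockConst M (fun z => Real.exp (-(dec d * torusSupNorm M (z - y))) * Real.exp (-(dec d * torusSupNorm M (z - y'))))]
    _ ≤ ((d : ℝ) + 1) ^ 4 * B * CdecD d ^ 2 * (latticeConst (d + 1) (dec d / 2) * Real.exp (-(dec d / 2 * torusSupNorm M (y - y')))) :=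
        mul_le_mul_of_nonneg_left (sum_exp_two_centre_le M (dec_pos d) y y') hK
    _ = _ := by ring

end Decay

/-! ## §4 The one-step clause along the tower -/

section Step

variable (L : ℕ) [NeZero L] (M : Fin (d + 1) → ℕ) [hM : ∀ μ, NeZero (M μ)]

/-- **LEIBNIZ AT ONE FINE POINT**: with `d′ = ∂H_{k+1}(x′)`, `d = ∂H_k(par x′)` (two legs each) and the vertex letters `|m′|,|m| ≤ B`,
`‖m′(x′) − m(par x′)‖ ≤ εm`, the differenced integrand obeys
`‖Σ_{ij}(m′ d′_i d′_j − m d_i d_j)‖ ≤ (d+1)⁴·(2·B·CdecD·CG·θG^k + CdecD²·εm)·e^{−dec|ȳ(x′)−y|}e^{−dec|ȳ(x′)−y′|}`. [folklore] -/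
theorem norm_vertex_sum_sub_le (hL : 2 ≤ L) (k : ℕ) (m' : Tor (fine (L * lev L k) M) → VIdx d → VIdx d → ℂ)
    (m : Tor (fine (lev L k) M) → VIdx d → VIdx d → ℂ) {B εm : ℝ} (hm' : ∀ x i j, ‖m' x i j‖ ≤ B) (hm : ∀ x i j, ‖m x i j‖ ≤ B)
    (htr : ∀ x' i j, ‖m' x' i j - m (par (lev L k) L M x') i j‖ ≤ εm) (x' : Tor (fine (L * lev L k) M)) (y y' : Fin (d + 1) → ℤ)
    (lam lam' : Fin (d + 1)) {α : ℝ} (hα0 : 0 ≤ α) (hα1 : α < 1) :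
    ‖∑ i : VIdx d, ∑ j : VIdx d,
        (m' x' i j * dker (L * lev L k) M i.1 lam i.2 x' (toT M y) * dker (L * lev L k) M j.1 lam' j.2 x' (toT M y')
          - m (par (lev L k) L M x') i j * dker (lev L k) M i.1 lam i.2 (par (lev L k) L M x') (toT M y)
              * dker (lev L k) M j.1 lam' j.2 (par (lev L k) L M x') (toT M y'))‖
      ≤ ((d : ℝ) + 1) ^ 4 * (2 * B * CdecD d * (CG d α L * thetaG L α ^ k) + CdecD d ^ 2 * εm)
          * (Real.exp (-(dec d * torusSupNorm M (rep M (blockOf (L * lev L k) M x') - y)))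
              * Real.exp (-(dec d * torusSupNorm M (rep M (blockOf (L * lev L k) M x') - y')))) := by
  have hL1 : 1 ≤ L := le_trans (by norm_num) hL
  set z := rep M (blockOf (L * lev L k) M x') with hz
  set E := Real.exp (-(dec d * torusSupNorm M (z - y)))
  set E' := Real.exp (-(dec d * torusSupNorm M (z - y')))
  have hB : 0 ≤ B := (norm_nonneg _).trans (hm' x' (0, 0) (0, 0))
  have hε : 0 ≤ εm := (norm_nonneg _).trans (htr x' (0, 0) (0, 0))
  have hC : 0 ≤ CdecD d := CdecD_nonneg
  have hρ : 0 ≤ CG d α L * thetaG L α ^ k := mul_nonneg (CG_nonneg d α L) (pow_nonneg (thetaG_pos hL1 α).le k)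
  obtain ⟨hx, hp⟩ := eq_bpt_and_par_eq (N := lev L k) (R := L) M x'
  have hdp : ∀ (μ l ν : Fin (d + 1)) (w : Fin (d + 1) → ℤ),
      ‖dker (lev L k) M μ l ν (par (lev L k) L M x') (toT M w)‖ ≤ CdecD d * Real.exp (-(dec d * torusSupNorm M (z - w))) := by
    intro μ l ν w
    rw [hp]
    have h := norm_dker_bpt_le (lev L k) M μ l ν (parDigit M x') z w
    rw [← dec_eq] at h; exact h
  have hd' : ∀ (μ l ν : Fin (d + 1)) (w : Fin (d + 1) → ℤ),
      ‖dker (L * lev L k) M μ l ν x' (toT M w)‖ ≤ CdecD d * Real.exp (-(dec d * torusSupNorm M (z - w))) :=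
    fun μ l ν w => norm_dker_le_block (L * lev L k) M μ l ν x' w
  have hdiff : ∀ (μ l ν : Fin (d + 1)) (w : Fin (d + 1) → ℤ),
      ‖dker (L * lev L k) M μ l ν x' (toT M w) - dker (lev L k) M μ l ν (par (lev L k) L M x') (toT M w)‖
        ≤ CG d α L * thetaG L α ^ k * Real.exp (-(dec d * torusSupNorm M (z - w))) :=
    fun μ l ν w => norm_dker_par_sub_le_lev L M hL k (x', μ) ν l w hα0 hα1
  have hterm : ∀ i j : VIdx d,
      ‖m' x' i j * dker (L * lev L k) M i.1 lam i.2 x' (toT M y) * dker (L * lev L k) M j.1 lam' j.2 x' (toT M y')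
          - m (par (lev L k) L M x') i j * dker (lev L k) M i.1 lam i.2 (par (lev L k) L M x') (toT M y)
              * dker (lev L k) M j.1 lam' j.2 (par (lev L k) L M x') (toT M y')‖
        ≤ (2 * B * CdecD d * (CG d α L * thetaG L α ^ k) + CdecD d ^ 2 * εm) * (E * E') := by
    intro i j
    set a' := m' x' i j
    set a := m (par (lev L k) L M x') i j
    set b' := dker (L * lev L k) M i.1 lam i.2 x' (toT M y)
    set b := dker (lev L k) M i.1 lam i.2 (par (lev L k) L M x') (toT M y)
    set c' := dker (L * lev L k) M j.1 lam' j.2 x' (toT M y')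
    set c := dker (lev L k) M j.1 lam' j.2 (par (lev L k) L M x') (toT M y')
    have e : a' * b' * c' - a * b * c = (b' - b) * a' * c' + b * (a' - a) * c' + b * a * (c' - c) := by ring
    rw [e]
    have h1 : ‖(b' - b) * a' * c'‖ ≤ (CG d α L * thetaG L α ^ k * E) * B * (CdecD d * E') := by
      rw [norm_mul, norm_mul]
      exact mul_le_mul (mul_le_mul (hdiff i.1 lam i.2 y) (hm' x' i j) (norm_nonneg _) (mul_nonneg hρ (Real.exp_pos _).le))
        (hd' j.1 lam' j.2 y') (norm_nonneg _) (mul_nonneg (mul_nonneg hρ (Real.exp_pos _).le) hB)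
    have h2 : ‖b * (a' - a) * c'‖ ≤ (CdecD d * E) * εm * (CdecD d * E') := by
      rw [norm_mul, norm_mul]
      exact mul_le_mul (mul_le_mul (hdp i.1 lam i.2 y) (htr x' i j) (norm_nonneg _) (mul_nonneg hC (Real.exp_pos _).le))
        (hd' j.1 lam' j.2 y') (norm_nonneg _) (mul_nonneg (mul_nonneg hC (Real.exp_pos _).le) hε)
    have h3 : ‖b * a * (c' - c)‖ ≤ (CdecD d * E) * B * (CG d α L * thetaG L α ^ k * E') := by
      rw [norm_mul, norm_mul]
      exact mul_le_mul (mul_le_mul (hdp i.1 lam i.2 y) (hm _ i j) (norm_nonneg _) (mul_nonneg hC (Real.exp_pos _).le))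
        (hdiff j.1 lam' j.2 y') (norm_nonneg _) (mul_nonneg (mul_nonneg hC (Real.exp_pos _).le) hB)
    calc _ ≤ ‖(b' - b) * a' * c'‖ + ‖b * (a' - a) * c'‖ + ‖b * a * (c' - c)‖ := norm_add₃_le
      _ ≤ _ := by nlinarith [h1, h2, h3, Real.exp_pos (-(dec d * torusSupNorm M (z - y))), Real.exp_pos (-(dec d * torusSupNorm M (z - y')))]
  calc _ ≤ ∑ i : VIdx d, ‖∑ j : VIdx d, (m' x' i j * dker (L * lev L k) M i.1 lam i.2 x' (toT M y) * dker (L * lev L k) M j.1 lam' j.2 x' (toT M y')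
          - m (par (lev L k) L M x') i j * dker (lev L k) M i.1 lam i.2 (par (lev L k) L M x') (toT M y)
              * dker (lev L k) M j.1 lam' j.2 (par (lev L k) L M x') (toT M y'))‖ := norm_sum_le _ _
    _ ≤ ∑ i : VIdx d, ∑ j : VIdx d, ‖m' x' i j * dker (L * lev L k) M i.1 lam i.2 x' (toT M y) * dker (L * lev L k) M j.1 lam' j.2 x' (toT M y')
          - m (par (lev L k) L M x') i j * dker (lev L k) M i.1 lam i.2 (par (lev L k) L M x') (toT M y)
              * dker (lev L k) M j.1 lam' j.2 (par (lev L k) L M x') (toT M y')‖ :=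
        Finset.sum_le_sum fun i _ => norm_sum_le _ _
    _ ≤ ∑ _i : VIdx d, ∑ _j : VIdx d, (2 * B * CdecD d * (CG d α L * thetaG L α ^ k) + CdecD d ^ 2 * εm) * (E * E') :=
        Finset.sum_le_sum fun i _ => Finset.sum_le_sum fun j _ => hterm i j
    _ = _ := by
        simp only [Finset.sum_const, Finset.card_univ, Fintype.card_prod, Fintype.card_fin, nsmul_eq_mul]
        push_cast; ring

/-- **THE ONE-STEP CLAUSE OF THE VERTEX CHAIN ALONG THE TOWER** (`L ≥ 2`, every torus, every level `k`, `0 ≤ α < 1`): if the vertex weights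
are bounded by `B` at both levels and transport against King's parent with error `εm` (`‖m′(x′,i,j) − m(par x′,i,j)‖ ≤ εm`), then
`‖K^{(n_{k+1})}[m′](y,λ;y′,λ′) − K^{(n_k)}[m](y,λ;y′,λ′)‖ ≤ (d+1)⁴·(2·B·CdecD·CG(d,α,L)·θG(L,α)^k + CdecD²·εm)·latticeConst(d+1, dec∕2)·e^{−(dec∕2)|y−y′|_T}`
— Leibniz over the children of the parent map (`sum_comp_par`) with this lineage's gradient-leg law for each leg.
[cite: King1986, §4 p.672 («we successively replace each factor by the corresponding one … and bound the error», the Leibniz mechanism); Balaban1984PropagatorsI, (1.63) p.28] [folklore] -/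
theorem norm_vtxChain_succ_sub_le_lev (hL : 2 ≤ L) (k : ℕ) (m' : Tor (fine (L * lev L k) M) → VIdx d → VIdx d → ℂ)
    (m : Tor (fine (lev L k) M) → VIdx d → VIdx d → ℂ) {B εm : ℝ} (hm' : ∀ x i j, ‖m' x i j‖ ≤ B) (hm : ∀ x i j, ‖m x i j‖ ≤ B)
    (htr : ∀ x' i j, ‖m' x' i j - m (par (lev L k) L M x') i j‖ ≤ εm) (y y' : Fin (d + 1) → ℤ) (lam lam' : Fin (d + 1))
    {α : ℝ} (hα0 : 0 ≤ α) (hα1 : α < 1) :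
    ‖vtxChain (L * lev L k) M m' (toT M y, lam) (toT M y', lam') - vtxChain (lev L k) M m (toT M y, lam) (toT M y', lam')‖
      ≤ ((d : ℝ) + 1) ^ 4 * (2 * B * CdecD d * (CG d α L * thetaG L α ^ k) + CdecD d ^ 2 * εm) * latticeConst (d + 1) (dec d / 2)
          * Real.exp (-(dec d / 2 * torusSupNorm M (y - y'))) := by
  have hL1 : 1 ≤ L := le_trans (by norm_num) hL
  have hB : 0 ≤ B := by
    have := hm' (bpt (L * lev L k) M 0 fun _ => ⟨0, Nat.pos_of_ne_zero (NeZero.ne _)⟩) (0, 0) (0, 0)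
    exact (norm_nonneg _).trans this
  have hε : 0 ≤ εm := by
    have := htr (bpt (L * lev L k) M 0 fun _ => ⟨0, Nat.pos_of_ne_zero (NeZero.ne _)⟩) (0, 0) (0, 0)
    exact (norm_nonneg _).trans this
  have hC : 0 ≤ CdecD d := CdecD_nonneg
  have hρ : 0 ≤ CG d α L * thetaG L α ^ k := mul_nonneg (CG_nonneg d α L) (pow_nonneg (thetaG_pos hL1 α).le k)
  have hK : 0 ≤ ((d : ℝ) + 1) ^ 4 * (2 * B * CdecD d * (CG d α L * thetaG L α ^ k) + CdecD d ^ 2 * εm) := by positivity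
  have hn' : (0 : ℝ) < (((L * lev L k : ℕ) : ℝ)) ^ (d + 1) := by
    have := Nat.pos_of_ne_zero (NeZero.ne (L * lev L k)); positivity
  set G : Tor (fine (lev L k) M) → ℂ := fun x => ∑ i : VIdx d, ∑ j : VIdx d,
      m x i j * dker (lev L k) M i.1 lam i.2 x (toT M y) * dker (lev L k) M j.1 lam' j.2 x (toT M y') with hG
  set G' : Tor (fine (L * lev L k) M) → ℂ := fun x' => ∑ i : VIdx d, ∑ j : VIdx d,
      m' x' i j * dker (L * lev L k) M i.1 lam i.2 x' (toT M y) * dker (L * lev L k) M j.1 lam' j.2 x' (toT M y') with hG'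
  have hcoarse : vtxChain (lev L k) M m (toT M y, lam) (toT M y', lam')
      = ∑ x' : Tor (fine (L * lev L k) M), (((((L * lev L k : ℕ) : ℝ)) ^ (d + 1))⁻¹ : ℝ) * G (par (lev L k) L M x') := by
    have key : ∀ (Gc : Tor (fine (lev L k) M) → ℂ),
        ∑ x' : Tor (fine (L * lev L k) M), ((((((L * lev L k : ℕ) : ℝ)) ^ (d + 1))⁻¹ : ℝ) : ℂ) * Gc (par (lev L k) L M x')
          = ∑ x : Tor (fine (lev L k) M), (((((lev L k : ℕ) : ℝ) ^ (d + 1))⁻¹ : ℝ) : ℂ) * Gc x := by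
      intro Gc
      have hR : ((L : ℂ)) ≠ 0 := by exact_mod_cast NeZero.ne L
      have hN : ((lev L k : ℕ) : ℂ) ≠ 0 := by exact_mod_cast NeZero.ne (lev L k)
      rw [← Finset.mul_sum, ← Finset.mul_sum]
      have htile : ∑ x' : Tor (fine (L * lev L k) M), Gc (par (lev L k) L M x') = (L : ℂ) ^ (d + 1) * ∑ x : Tor (fine (lev L k) M), Gc x := by
        rw [← Fintype.sum_equiv (tileEquiv (lev L k) L M) (fun p => Gc (par (lev L k) L M (tileEquiv (lev L k) L M p)))
          (fun x' => Gc (par (lev L k) L M x')) (fun _ => rfl), Fintype.sum_prod_type]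
        simp only [tileEquiv, Equiv.coe_fn_mk, par_cpt_add_off, Finset.sum_const, Finset.card_univ, Fintype.card_pi,
          Fintype.card_fin, Finset.prod_const, nsmul_eq_mul]
        rw [Finset.mul_sum]
        refine Finset.sum_congr rfl fun x _ => ?_
        push_cast; ring
      rw [htile, ← mul_assoc]
      congr 1
      push_cast
      rw [mul_pow, mul_inv]
      field_simp
    unfold vtxChain
    rw [← key G]
  rw [hcoarse]
  unfold vtxChain
  rw [← Finset.sum_sub_distrib]
  calc _ ≤ ∑ x' : Tor (fine (L * lev L k) M), ‖((((((L * lev L k : ℕ) : ℝ)) ^ (d + 1))⁻¹ : ℝ) : ℂ) * G' x'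
          - ((((((L * lev L k : ℕ) : ℝ)) ^ (d + 1))⁻¹ : ℝ) : ℂ) * G (par (lev L k) L M x')‖ := norm_sum_le _ _
    _ ≤ ∑ x' : Tor (fine (L * lev L k) M), ((((L * lev L k : ℕ) : ℝ)) ^ (d + 1))⁻¹ *
          (((d : ℝ) + 1) ^ 4 * (2 * B * CdecD d * (CG d α L * thetaG L α ^ k) + CdecD d ^ 2 * εm) *
            (Real.exp (-(dec d * torusSupNorm M (rep M (blockOf (L * lev L k) M x') - y)))
              * Real.exp (-(dec d * torusSupNorm M (rep M (blockOf (L * lev L k) M x') - y'))))) := by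
        refine Finset.sum_le_sum fun x' _ => ?_
        rw [← mul_sub, norm_mul, Complex.norm_real, Real.norm_of_nonneg (inv_nonneg.mpr hn'.le)]
        refine mul_le_mul_of_nonneg_left ?_ (inv_nonneg.mpr hn'.le)
        have h := norm_vertex_sum_sub_le L M hL k m' m hm' hm htr x' y y' lam lam' hα0 hα1
        rw [hG', hG]
        dsimp only
        rw [← Finset.sum_sub_distrib]
        simp_rw [← Finset.sum_sub_distrib]
        exact h
    _ = ((d : ℝ) + 1) ^ 4 * (2 * B * CdecD d * (CG d α L * thetaG L α ^ k) + CdecD d ^ 2 * εm) *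
          ∑ x' : Tor (fine (L * lev L k) M), ((((L * lev L k : ℕ) : ℝ)) ^ (d + 1))⁻¹ *
            (Real.exp (-(dec d * torusSupNorm M (rep M (blockOf (L * lev L k) M x') - y)))
              * Real.exp (-(dec d * torusSupNorm M (rep M (blockOf (L * lev L k) M x') - y')))) := by
        rw [Finset.mul_sum]; refine Finset.sum_congr rfl fun x _ => ?_; ring
    _ = ((d : ℝ) + 1) ^ 4 * (2 * B * CdecD d * (CG d α L * thetaG L α ^ k) + CdecD d ^ 2 * εm) *
          ∑ t : Tor M, Real.exp (-(dec d * torusSupNorm M (rep M t - y))) * Real.exp (-(dec d * torusSupNorm M (rep M t - y'))) := by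
        rw [sum_blockConst M (fun z => Real.exp (-(dec d * torusSupNorm M (z - y))) * Real.exp (-(dec d * torusSupNorm M (z - y'))))]
    _ ≤ ((d : ℝ) + 1) ^ 4 * (2 * B * CdecD d * (CG d α L * thetaG L α ^ k) + CdecD d ^ 2 * εm) *
          (latticeConst (d + 1) (dec d / 2) * Real.exp (-(dec d / 2 * torusSupNorm M (y - y')))) :=
        mul_le_mul_of_nonneg_left (sum_exp_two_centre_le M (dec_pos d) y y') hK
    _ = _ := by ring

end Step

end Summit.QuantumFields.BalabanUV.Beta.GAN24.GradientVertexChainKing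

end
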